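import Summits.Ventures.HSemireg.AmplificationChainEtaleFamily
import Summits.Ventures.HSemireg.ArtinianPresentation
import HarnessLib

/-!
# Venture HSemireg — SATISFIABILITY WITNESS for the object-level étale shape `PerfectComplexExtendsOverEtaleNbhdAt`

HONEST FRAMING. Lean index of the computation cell `pub-hsemireg` (theory seat 3). Nothing about any explicit variety is
asserted; nothing here says HC, HC_CM or HC_AV is proved. Theorems only (0 `def`, 0 `sorry`, no new axiom, no named fact).
For the red team's vacuity lens: the predicate `PerfectComplexExtendsOverEtaleNbhdAt π s₀ X₀ e E` of
`AmplificationChainEtaleFamily.lean` (the conclusion shape of `PerfectLiftsAlgebraise π`, rung R2/R3 of the g = 4 trust-base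
ladder) is INHABITED in the tautological situation — a bounded complex of vector bundles that extends GLOBALLY over `𝒳`
satisfies it with `T = S`, `ρ = 𝟙_S`, `ℰ = pr_𝒳^* ℱ`, the canonical fibre identification and the identity roof (sister of
theory seat 3's `PerfectComplexChartSpread` §4 «a GLOBAL extension gives the conclusion outright»). [folklore]
-/

noncomputable section

open CategoryTheory CategoryTheory.Limits AlgebraicGeometry
open Literature.AlgebraicGeometry.Motives Literature.AlgebraicGeometry.HodgeTheory
open Literature.AlgebraicGeometry.KTheory

namespace Summit.Ventures.HSemireg

/-! ## NON-VACUITY WITNESS: a complex that extends GLOBALLY over `𝒳` satisfies the étale-shape predicate -/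

section Witness

/-- **Satisfiability witness for `PerfectComplexExtendsOverEtaleNbhdAt`**: if `E` is (isomorphic on the nose to) the
restriction to `X₀ ≅ 𝒳_{s₀}` of a bounded complex of vector bundles `ℱ` on `𝒳` itself, the predicate holds with
`T = S`, `ρ = 𝟙`, `ℰ = pr_𝒳^* ℱ`, `ε` the canonical identification and the identity roof. [folklore] -/
theorem perfectComplexExtendsOverEtaleNbhdAt_of_global {𝒳 S : SchemeOver ℂ} (π : 𝒳 ⟶ S) (s₀ : ComplexPoints S)
    (ℱ : CochainComplex 𝒳.left.Modules ℤ) (hℱ : IsBoundedVBComplex ℱ) :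
    PerfectComplexExtendsOverEtaleNbhdAt π s₀ (fiberOver π s₀) (Iso.refl _)
      (((Scheme.Modules.pullback (fiberι π s₀).left).mapHomologicalComplex (ComplexShape.up ℤ)).obj ℱ) := by
  have hEt : Etale (𝟙 S : S ⟶ S).left := by
    rw [Over.id_left]
    infer_instance
  -- ε : 𝒳_{s₀} ≅ (𝒳 ×_S S)_{s₀} is the inverse of the canonical fibre identification (at the point 𝟙(s₀) = s₀)
  let ε : fiberOver π s₀ ≅ fiberOver (familyPullback.snd π (𝟙 S)) s₀ :=
    (fiberOverFamilyPullbackIso π (𝟙 S) s₀ ≪≫ eqToIso (congrArg (fiberOver π) (AlgPoints.map_id_apply s₀))).symm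
  have hε : ε.hom ≫ fiberι (familyPullback.snd π (𝟙 S)) s₀ ≫ familyPullback.fst π (𝟙 S) =
      (Iso.refl _).hom ≫ fiberι π s₀ := by
    change ((fiberOverFamilyPullbackIso π (𝟙 S) s₀ ≪≫
        eqToIso (congrArg (fiberOver π) (AlgPoints.map_id_apply s₀))).inv) ≫ _ ≫ _ = _
    rw [Iso.trans_inv, eqToIso.inv, Category.assoc, ← fiberOverFamilyPullbackIso_hom_fiberι π (𝟙 S) s₀,
      Iso.inv_hom_id_assoc, Iso.refl_hom, Category.id_comp]
    exact eqToHom_comp_fiberι' π (AlgPoints.map_id_apply s₀).symm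
  -- the restriction of `pr_𝒳^* ℱ` along `ε ≫ ι_{s₀}` is TERMWISE the restriction of `ℱ` along `ι_{s₀}`
  let ℰ := ((Scheme.Modules.pullback (familyPullback.fst π (𝟙 S)).left).mapHomologicalComplex (ComplexShape.up ℤ)).obj ℱ
  have hcomp : (ε.hom ≫ fiberι (familyPullback.snd π (𝟙 S)) s₀).left ≫ (familyPullback.fst π (𝟙 S)).left =
      (fiberι π s₀).left := by
    rw [← Over.comp_left, Category.assoc, hε, Over.comp_left, Iso.refl_hom, Over.id_left, Category.id_comp]
  let ι : ((Scheme.Modules.pullback (fiberι π s₀).left).mapHomologicalComplex (ComplexShape.up ℤ)).obj ℱ ≅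
      ((Scheme.Modules.pullback (ε.hom ≫ fiberι (familyPullback.snd π (𝟙 S)) s₀).left).mapHomologicalComplex
        (ComplexShape.up ℤ)).obj ℰ :=
    (NatIso.mapHomologicalComplex (Scheme.Modules.pullbackCongr hcomp.symm ≪≫
      (Scheme.Modules.pullbackComp (ε.hom ≫ fiberι (familyPullback.snd π (𝟙 S)) s₀).left
        (familyPullback.fst π (𝟙 S)).left).symm) (ComplexShape.up ℤ)).app ℱ
  exact ⟨S, 𝟙 S, hEt, s₀, AlgPoints.map_id_apply s₀, ℰ, hℱ.pullback _, ε, hε, _, hℱ.pullback _, ι.hom, 𝟙 _,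
    inferInstance, inferInstance⟩

end Witness

end Summit.Ventures.HSemireg

end
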